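import Mathlib
import Summits.Ventures.HodgeRepro.Tier4.Line4.CharacterExtend

/-!
# Tier4/Line4/CharacterExtendPair — the JOINT extension: a character of `A` trivial on a closed cocompact `Γ` with
PRESCRIBED restrictions to a compact subgroup `K` AND to a closed cocompact subgroup `Z`, from the typed print [DE14]
Cor. 3.6.2 (C-L4-B-EXTEND, part 4 = the generic half of (r5): the PAIR `(chi, chi′)` with `chi_centre`)

Blind re-derivation cell `pub-hodge-repro`, Tier 4 «prove the step» (README §9–§10), seat t4-x2 (reserve
wall-breaker, gen 6; GO S16576).  Tree path `lean/Summits/Ventures/HodgeRepro/Tier4/Line4/CharacterExtendPair.lean`.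
Imports: Mathlib + `Tier4/Line4/CharacterExtend` (the generic extension; `Tier4/LitCharacterExtension` through it).
No definition, no instance, no printed theorem proved.

WHY.  The wall's `RTFData` asks the PAIR `(chi, chi′)` to AGREE ON THE CENTRE (`chi_centre`, N2).  CharacterExtend /
WeightCharacterSeesaw(Prime) extend the two archimedean weight characters INDEPENDENTLY; the second extension must also
be prescribed on `Z(𝔸)` by the first.  Generic form: `A` a commutative topological group, `Γ` closed with `A ⧸ Γ`
compact, `K` a compact subgroup, `Z` a CLOSED subgroup cocompact modulo `Γ` (`Z ⊆ Γ · D`, `D ⊆ Z` compact), `ψ`, `ω`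
continuous characters of `K`, `Z`, CONSISTENT on the rational points of `K · Z`
(`hcons : ∀ t z, t * z ∈ Γ → ψ t * ω z = 1`) — then a continuous character `χ` of `A`, trivial on `Γ`, restricting to
`ψ` on `K` and to `ω` on `Z`, exists modulo the print on `A ⧸ Γ`.  Proof: the image `B` of `K · Z` in `A ⧸ Γ` is the
image of the compact `K · D`, hence closed; `ψ · ω` descends from `K × Z` to `B` through the kernel (`hcons`, Noether's
first isomorphism theorem `QuotientGroup.quotientKerEquivRange`); continuity from the compact `K × (Z ∩ D)` onto the
Hausdorff `B` (a closed map, hence a quotient map); the print extends from `B`; compose with `mk`.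
* `exists_continuousMonoidHom_extend_pair_of_print` — the statement above.
WHAT `hcons` IS at the torus: for `t ∈ T′_∞`, `z ∈ Z(𝔸)` with `t z ∈ T′(k)`, `ψ′(t) · chi(z) = 1` — the rational points
of `Z(𝔸) · T′_∞` (a rational element whose finite part is central lies in `T(k)` — k → k_v injective — so `t ∈ T_∞ ∩
T′_∞` and the clause is the agreement of the two weight characters on `T_∞ ∩ T′_∞`); that torus-side reduction is the
consumer's (NOT proved here).  Nothing here says anything about the status of the Hodge conjecture for CM abelian
varieties, which is NOT proved; HC_CM is NOT proved by anyone in this repository.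
-/

set_option autoImplicit false

noncomputable section

namespace Summit.Ventures.HodgeRepro.Tier4.Line4

open Summit.Ventures.HodgeRepro.Tier4.Lit Topology

section GenericPair

variable {A : Type*} [CommGroup A] [TopologicalSpace A] [IsTopologicalGroup A]

/-- **Joint extension from a compact subgroup `K` and a closed cocompact subgroup `Z`, modulo the print.**
`Γ` closed with `A ⧸ Γ` compact; `K` compact; `Z` closed with `Z ⊆ Γ · D` for a compact `D ⊆ Z`; `ψ`, `ω` continuous
characters of `K`, `Z`; `hcons`: `t * z ∈ Γ → ψ t * ω z = 1`.  Then some continuous character `χ` of `A` is trivial on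
`Γ`, equals `ψ` on `K` and `ω` on `Z`. -/
theorem exists_continuousMonoidHom_extend_pair_of_print (Γ K Z : Subgroup A)
    [IsClosed (Γ : Set A)] [CompactSpace (A ⧸ Γ)]
    (hK : IsCompact (K : Set A)) (hZc : IsClosed (Z : Set A))
    (hZ : ∃ D : Set A, IsCompact D ∧ D ⊆ (Z : Set A) ∧ ∀ z ∈ Z, ∃ γ ∈ Γ, ∃ d ∈ D, z = γ * d)
    (hDE : DeitmarEchterhoff2014_Cor_3_6_2_restriction_surjective (A ⧸ Γ))
    (ψ : ContinuousMonoidHom K Circle) (ω : ContinuousMonoidHom Z Circle)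
    (hcons : ∀ (t : K) (z : Z), (t : A) * (z : A) ∈ Γ → ψ t * ω z = 1) :
    ∃ χ : ContinuousMonoidHom A Circle,
      (∀ γ ∈ Γ, χ γ = 1) ∧ (∀ t : K, χ (t : A) = ψ t) ∧ ∀ z : Z, χ (z : A) = ω z := by
  obtain ⟨D, hDc, hDZ, hcov⟩ := hZ
  -- the character `ψ · ω` of `K × Z`
  let F : ContinuousMonoidHom (K × Z) Circle :=
    { toFun := fun p => ψ p.1 * ω p.2
      map_one' := by simp
      map_mul' := fun p p' => by
        simp only [Prod.fst_mul, Prod.snd_mul, map_mul]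
        exact mul_mul_mul_comm _ _ _ _
      continuous_toFun := (ψ.continuous.comp continuous_fst).mul (ω.continuous.comp continuous_snd) }
  -- the map `K × Z → A ⧸ Γ`, `(t, z) ↦ mk (t * z)`, and its range `B`
  let g : K × Z →* A ⧸ Γ := (QuotientGroup.mk' Γ).comp (K.subtype.coprod Z.subtype)
  have hg_apply : ∀ p : K × Z, g p = QuotientGroup.mk ((p.1 : A) * (p.2 : A)) := fun p => rfl
  have hg_cont : Continuous g := by
    refine QuotientGroup.continuous_mk.comp ?_
    exact (continuous_subtype_val.comp continuous_fst).mul (continuous_subtype_val.comp continuous_snd)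
  let B : Subgroup (A ⧸ Γ) := g.range
  -- `ψ · ω` is trivial on the kernel of `g` (the consistency clause)
  have hker : g.ker ≤ F.toMonoidHom.ker := by
    intro p hp
    rw [MonoidHom.mem_ker, hg_apply, QuotientGroup.eq_one_iff] at hp
    rw [MonoidHom.mem_ker]
    exact hcons p.1 p.2 hp
  -- the descended character on `B` (Noether)
  let φ₀ : (K × Z) ⧸ g.ker →* Circle := QuotientGroup.lift g.ker F.toMonoidHom hker
  let e : (K × Z) ⧸ g.ker ≃* B := QuotientGroup.quotientKerEquivRange g
  let φ : B →* Circle := φ₀.comp e.symm.toMonoidHom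
  have he : ∀ p : K × Z, e (QuotientGroup.mk p) = g.rangeRestrict p := fun p => rfl
  have hφ : ∀ p : K × Z, φ (g.rangeRestrict p) = F p := by
    intro p
    show φ₀ (e.symm (g.rangeRestrict p)) = F p
    rw [← he p, MulEquiv.symm_apply_apply]
    rfl
  -- continuity of `φ`: `B` is the image of the compact `K × (Z ∩ D)`, a quotient map onto the Hausdorff `B`
  let S : Set (K × Z) := {p | (p.2 : A) ∈ D}
  have hS : IsCompact S := by
    have h1 : S = (Set.univ : Set K) ×ˢ (Subtype.val ⁻¹' D : Set Z) := by
      ext p; simp [S]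
    rw [h1]
    haveI : CompactSpace K := isCompact_iff_compactSpace.mp hK
    exact isCompact_univ.prod (hZc.isClosedEmbedding_subtypeVal.isCompact_preimage hDc)
  haveI : CompactSpace S := isCompact_iff_compactSpace.mp hS
  let r : S → B := fun p => g.rangeRestrict p.1
  have hr_cont : Continuous r := by
    apply Continuous.subtype_mk
    exact hg_cont.comp continuous_subtype_val
  have hr_surj : Function.Surjective r := by
    rintro ⟨b, p, rfl⟩
    obtain ⟨γ, hγ, d, hd, hz⟩ := hcov (p.2 : A) p.2.2
    refine ⟨⟨(p.1, ⟨d, hDZ hd⟩), hd⟩, ?_⟩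
    apply Subtype.ext
    show g (p.1, ⟨d, hDZ hd⟩) = g p
    rw [hg_apply, hg_apply]
    show QuotientGroup.mk ((p.1 : A) * d) = QuotientGroup.mk ((p.1 : A) * (p.2 : A))
    rw [QuotientGroup.eq, hz]
    have : ((p.1 : A) * d)⁻¹ * ((p.1 : A) * (γ * d)) = γ := by
      rw [show (p.1 : A) * (γ * d) = (p.1 : A) * d * γ by rw [mul_comm γ d, ← mul_assoc], inv_mul_cancel_left]
    rw [this]
    exact hγ
  have hr_quot : IsQuotientMap r := (hr_cont.isClosedMap).isQuotientMap hr_cont hr_surj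
  have hφ_cont : Continuous φ := by
    rw [hr_quot.continuous_iff]
    have : (φ ∘ r) = fun p : S => F p.1 := by
      funext p
      exact hφ p.1
    rw [this]
    exact F.continuous.comp continuous_subtype_val
  -- `B` is compact (image of `S`), hence closed in the Hausdorff quotient
  have hBcl : IsClosed (B : Set (A ⧸ Γ)) := by
    have hB : (B : Set (A ⧸ Γ)) = Subtype.val '' (Set.range r) := by
      rw [hr_surj.range_eq, Set.image_univ, Subtype.range_coe]
    rw [hB]
    exact ((isCompact_range hr_cont).image continuous_subtype_val).isClosed
  -- the print on `B`
  let φc : ContinuousMonoidHom B Circle := { φ with continuous_toFun := hφ_cont }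
  obtain ⟨χ'', hχ''⟩ := hDE B hBcl φc
  let π : ContinuousMonoidHom A (A ⧸ Γ) := { QuotientGroup.mk' Γ with continuous_toFun := QuotientGroup.continuous_mk }
  refine ⟨χ''.comp π, ?_, ?_, ?_⟩
  · intro γ hγ
    have h1 : (QuotientGroup.mk γ : A ⧸ Γ) = 1 := (QuotientGroup.eq_one_iff γ).mpr hγ
    show χ'' (QuotientGroup.mk γ) = 1
    rw [h1, map_one]
  · intro t
    have h1 : (QuotientGroup.mk (t : A) : A ⧸ Γ) = ((g.rangeRestrict (t, (1 : Z)) : B) : A ⧸ Γ) := by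
      rw [MonoidHom.coe_rangeRestrict, hg_apply]
      simp
    show χ'' (QuotientGroup.mk (t : A)) = ψ t
    rw [h1, hχ'']
    show φ (g.rangeRestrict (t, (1 : Z))) = ψ t
    rw [hφ]
    show ψ t * ω 1 = ψ t
    rw [map_one, mul_one]
  · intro z
    have h1 : (QuotientGroup.mk (z : A) : A ⧸ Γ) = ((g.rangeRestrict ((1 : K), z) : B) : A ⧸ Γ) := by
      rw [MonoidHom.coe_rangeRestrict, hg_apply]
      simp
    show χ'' (QuotientGroup.mk (z : A)) = ω z
    rw [h1, hχ'']
    show φ (g.rangeRestrict ((1 : K), z)) = ω z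
    rw [hφ]
    show ψ 1 * ω z = ω z
    rw [map_one, one_mul]

end GenericPair

end Summit.Ventures.HodgeRepro.Tier4.Line4

end
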